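import Literature.Topology.FourManifolds.BoundaryFlowout
import Literature.Topology.FourManifolds.RegularSlabField
import Literature.Topology.FourManifolds.CollarTheorem
import HarnessLib

/-!
# A collar along which an adapted Morse function is the height

Topic `Literature/Topology/FourManifolds`; a complement to `CollarTheorem.lean`
(`BoundaryData.nonempty_collar_of_compactSpace`: Milnor's flow-out collar of the boundary of a
compact manifold with boundary, *Lectures on the h-cobordism theorem* (1965), proof of Thm. 3.4).
For the Kosinski converse of roadmap brick K (`PresentationHandlebodyFiveProofs.lean`: a 2-handle
attached along a *standard* attaching map — a tube of a circle in `∂V` prolonged along a collar,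
`TwoHandleFromCollar.lean` — carries a Morse function with one new critical point, Kosinski,
*Differential Manifolds* (1993), VII (2.2)) the collar must be **adapted to the Morse function
`f` of the handlebody `V`**: `f` must be an affine function of the collar height, as Kosinski's
model tube map `h` of VII (2.2.5) is with respect to `f = -|x_λ|² + |x_μ|²`.

**Theorem** (`IsMorseAdapted.exists_collar_apply_eq`).  Let `V` be a compact manifold with
boundary and `f : V → ℝ` a Morse function adapted to `∂V` (`IsMorseAdapted`: `f = 1` and `df ≠ 0`
on `∂V`, `f < 1` inside).  Then every boundary datum `b` of `V` has a collar `c : ∂V × [0, 1] → V`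
and a `κ > 0` with `f (c (x, t)) = 1 - κ t` for all `x ∈ ∂V`, `t ∈ [0, 1]`.

**Proof** (Milnor 1965, proof of Thm. 3.4, with the boundary-defining function `1 - f`).  The
function `g = 1 - f ≥ 0` vanishes exactly on `∂V` and is regular there, hence on some `{g ≤ δ}`
(`exists_pos_forall_mfderiv_ne_zero`); a smooth field `ξ` with `ξ(g) = 1` on `{g ≤ δ}`
(`exists_contMDiffSection_mlineDeriv_eq_one_on`) completes a `FlowoutInput`, whose flow-out
`Fl` satisfies `g (Fl z t) = g z + t` (`FlowoutInput.Cover.f_Fl`); the collar of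
`FlowoutInput.Cover.openCollarData` is `c (x, t) = Fl (incl x) (t a / 2)`, so
`f (c (x, t)) = 1 - (a / 2) t`.

Everything here is proved; no definitions, no named facts.

## References

* J. Milnor, *Lectures on the h-cobordism theorem*, Princeton (1965), proof of Thm. 3.4, Def. 3.1.
  [MilnorHCobordism1965]
* A. A. Kosinski, *Differential Manifolds*, Academic Press (1993), VII (2.2.5). [Kosinski1993]
-/

open scoped Manifold ContDiff Topology
open Set Function

noncomputable section

namespace Literature.Topology.FourManifolds

universe u

variable {n : ℕ} {M : Type u} [TopologicalSpace M] [T2Space M] [CompactSpace M]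
  [ChartedSpace (EuclideanHalfSpace (n + 2)) M] [IsManifold (𝓡∂ (n + 2)) ∞ M]

/-- **Flow-out input from an adapted Morse function**: for `f` Morse adapted to `∂M` there is a
`FlowoutInput` whose boundary-defining function is `1 - f` (Milnor 1965, proof of Thm. 3.4, the
regularity of `1 - f` near `∂M` from `exists_pos_forall_mfderiv_ne_zero` and the unit field from
`exists_contMDiffSection_mlineDeriv_eq_one_on`). [cite: MilnorHCobordism1965, proof of Thm. 3.4] -/
theorem IsMorseAdapted.exists_flowoutInput_f_eq {f : M → ℝ} (hf : IsMorseAdapted (𝓡∂ (n + 2)) f) :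
    ∃ D : FlowoutInput (n + 1) M, D.f = fun z => 1 - f z := by
  classical
  have hf₁ : ContMDiff (𝓡∂ (n + 2)) 𝓘(ℝ, ℝ) ∞ f := hf.isMorse.contMDiff
  set g : M → ℝ := fun z => 1 - f z with hg
  have hgs : ContMDiff (𝓡∂ (n + 2)) 𝓘(ℝ, ℝ) ∞ g :=
    ((contDiff_const (c := (1 : ℝ))).sub contDiff_id).contMDiff.comp hf₁
  have hgb : ∀ z, g z = 0 ↔ z ∈ (𝓡∂ (n + 2)).boundary M := by
    intro z
    constructor
    · intro hz
      by_contra hzb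
      have hzi : (𝓡∂ (n + 2)).IsInteriorPoint z :=
        ((𝓡∂ (n + 2)).isInteriorPoint_or_isBoundaryPoint z).resolve_right hzb
      have h := hf.2.2 z hzi
      simp only [hg] at hz
      linarith
    · intro hz
      simp only [hg, (hf.2.1 z hz).1, sub_self]
  have hg0 : ∀ z, 0 ≤ g z := by
    intro z
    rcases (𝓡∂ (n + 2)).isInteriorPoint_or_isBoundaryPoint z with hzi | hzb
    · have h := hf.2.2 z hzi
      simp only [hg]; linarith
    · simp only [hg, (hf.2.1 z hzb).1, sub_self, le_refl]
  have hreg : ∀ z, g z = 0 → mfderiv (𝓡∂ (n + 2)) 𝓘(ℝ, ℝ) g z ≠ 0 := by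
    intro z hz hcrit
    have hzb := (hgb z).1 hz
    have hgz : HasMFDerivAt (𝓡∂ (n + 2)) 𝓘(ℝ, ℝ) g z 0 :=
      hcrit ▸ (hgs.mdifferentiableAt (by simp)).hasMFDerivAt
    have h1 := (hasMFDerivAt_const (I := 𝓡∂ (n + 2)) (I' := 𝓘(ℝ, ℝ)) (1 : ℝ) z).sub hgz
    have heq : ((fun _ : M => (1 : ℝ)) - g) = f := by
      funext x; simp [hg]
    rw [heq] at h1
    have h2 : mfderiv (𝓡∂ (n + 2)) 𝓘(ℝ, ℝ) f z = 0 := by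
      rw [h1.mfderiv]; exact sub_self _
    exact (hf.2.1 z hzb).2 h2
  obtain ⟨δ', hδ', hδ'reg⟩ := exists_pos_forall_mfderiv_ne_zero hgs hg0 hreg
  set δ := δ' / 2 with hδ
  have hδpos : 0 < δ := by positivity
  have hreg2 : ∀ z ∈ {z : M | g z ≤ δ}, mfderiv (𝓡∂ (n + 2)) 𝓘(ℝ, ℝ) g z ≠ 0 := fun z hz =>
    hδ'reg z (by simp only [mem_setOf_eq] at hz; linarith)
  obtain ⟨ξ, hξ⟩ := exists_contMDiffSection_mlineDeriv_eq_one_on hgs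
    (isClosed_le hgs.continuous continuous_const) hreg2
  exact ⟨⟨g, ξ, δ, hδpos, hgs, hg0, hgb, ξ.contMDiff, fun z hz => hξ z hz⟩, rfl⟩

/-- **A collar along which an adapted Morse function is the height.**  For a compact manifold
with boundary `M` and `f : M → ℝ` Morse adapted to `∂M`, every boundary datum `b` (with `∂M`
nonempty) has a collar `c` and a `κ > 0` with `f (c (x, t)) = 1 - κ t` on `∂M × [0, 1]`
(Milnor's flow-out collar for the boundary-defining function `1 - f`: along the flow-out
`g (Fl z t) = g z + t`). [cite: MilnorHCobordism1965, proof of Thm. 3.4] -/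
theorem IsMorseAdapted.exists_collar_apply_eq {f : M → ℝ} (hf : IsMorseAdapted (𝓡∂ (n + 2)) f)
    (b : BoundaryData (𝓡∂ (n + 2)) M (𝓡 (n + 1))) [Nonempty b.carrier] :
    ∃ (c : b.Collar) (κ : ℝ), 0 < κ ∧ ∀ (x : b.carrier) (t : Set.Icc (0 : ℝ) 1),
      f (c (x, t)) = 1 - κ * t := by
  obtain ⟨D, hD⟩ := hf.exists_flowoutInput_f_eq
  obtain ⟨Γ⟩ := D.nonempty_cover
  refine ⟨(Γ.openCollarData b).toCollar, Γ.a / 2, by linarith [Γ.a_pos], fun x t => ?_⟩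
  have hx0 : D.f (b.incl x) = 0 := D.f_incl b x
  have hx : D.f (b.incl x) ≤ Γ.a := by rw [hx0]; exact Γ.a_pos.le
  have hta : (t : ℝ) * (Γ.a / 2) ∈ Icc (-D.f (b.incl x)) Γ.a := by
    rw [hx0, neg_zero]
    constructor <;> nlinarith [t.2.1, t.2.2, Γ.a_pos]
  have h1 : D.f (Γ.Fl (b.incl x) ((t : ℝ) * (Γ.a / 2))) = (t : ℝ) * (Γ.a / 2) := by
    rw [Γ.f_Fl hx hta, hx0, zero_add]
  have h2 : ((Γ.openCollarData b).toCollar : b.carrier × Set.Icc (0 : ℝ) 1 → M) (x, t) =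
      Γ.Fl (b.incl x) ((t : ℝ) * (Γ.a / 2)) := rfl
  rw [h2]
  have h3 : D.f (Γ.Fl (b.incl x) ((t : ℝ) * (Γ.a / 2))) =
      1 - f (Γ.Fl (b.incl x) ((t : ℝ) * (Γ.a / 2))) := by rw [hD]
  rw [h3] at h1
  linarith

end Literature.Topology.FourManifolds

end
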